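import Summits.ResolutionOfSingularities.ResolutionOfSingularities.Theorems.PurelyInseparableDim4ResConeCInfLayerStepPrime
import Summits.ResolutionOfSingularities.ResolutionOfSingularities.Theorems.PurelyInseparableDim4ResConeCInfKillersPrime
import Summits.ResolutionOfSingularities.ResolutionOfSingularities.Theorems.PurelyInseparableDim4ResConeCInfSharpFlagPrime
import HarnessLib
import HarnessLib.Audit.Tags

/-!
# Purely inseparable four-folds — ENTRY♯ CORE of the flagless branch, every prime: from a flagless letter change to REGIME R in two
# translated slot steps, and the propagation of the ♯-frame data (ledger, regime R, LAYER, ♯-flag `g`) through one more step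
# (cell `res-dim4-pi`, K2(p) lane, power-cone light-pair line, flagless branch, FILE ♯8-core)

[OURS · counted 0 · cell `res-dim4-pi` · K2(p) lane (holder res-dim4-p-12 g5); seat res-dim4-p-3 g6 (MEMO `res-dim4-p-3/MEMO-g6-FLAGLESS-SHARP.md`
§2–§3, port plan §6 ♯8).]  Nothing here proves K2(p) for any `p`, any TAIL(p, p−1, 3), `NoIsolatedTrap p p`, the Cossart–Jannsen–Saito theorem or
resolution of singularities in dimension ≥ 4 / characteristic `p` — NOT proved.  AI kernel work, weaker than expert review.  Exponent algebra.

F-exponents `(e_j, e_i, e_u, e_f)`; `d + 1 = p`; «in regime» for a state = every monomial has degree `≥ d + 3` or is the cone `x_j x_i x_f^d`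
(order `d + 2`, straight, in support form: res-dim4-typ-1 g6's `reg_of_straight`); the steps are slot steps translated along `u`
(res-dim4-typ-1 g6's `virtual_core_any_prime` + (VT-f) put every real step of a light-pair chain in this form in the virtual frame).
* §1 **`sharpEntry_step_prime`** — PROPAGATION: parent in regime with the exact ledger, REGIME R (`e_f + 2 ≤ d ⇒ e_j, e_i ≥ 3`) and LAYER (no
  degree `d + 3` with `e_f + 2 ≤ d`); child `κ(β)` in regime; grandchild (either slot, any `β′`) in regime ⇒ the CHILD has the exact ledger, regime R,
  LAYER (♯2b — the killer hypothesis of `layer_step_change_prime` is discharged by regime R: a killer has `e_i = 2`), and the same ♯-flag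
  coefficient `g` (♯3); if moreover the child is ISOLATED and `d ≤ 6` then `g ≠ 0` (♯4).  Mirror for `o(β)` by `j ↔ i`.
* §2 **`sharpEntry_start_prime`** — START: parent in regime with the exact ledger and FLAGLESS; `S₁ = κ(β₀)` in regime and free of κ-KILLERS
  (in an infinite chain: ♯3 + the free-tail lemma); `S₂ = o(β₁) S₁` in regime; `S₃` = a further slot step of `S₂` in regime ⇒ `S₂` has the exact
  ledger, regime R and LAYER (♯2 `letterChange_layer_prime` at the parent, ♯2b twice).  With §1 at `S₂ → S₃` (and `S₃` isolated): `g ≠ 0` from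
  `S₃` on — the ♯-frame data the ENTRY♯ hands to res-dim4-typ-1 g6's second Tschirnhaus♯ and ♯-window.
[cite: Hauser2010, §§F–G] [cite: CossartJannsenSaito2020, Thm. 3.14]
bears_on: LADDER-RESOLUTION:D157-DOOR2 (res-dim4-pi · K2(p) · power cones · flagless branch ♯8-core).  Supports
stmt-ResolutionOfSingularities-16155 (helper).
-/

set_option linter.dupNamespace false -- mandated namespace of this single-conjunct summit

noncomputable section

namespace Summit.ResolutionOfSingularities.ResolutionOfSingularities.Theorems.PIDim4

namespace ResCone

open MvPolynomial Finset
open Literature.AlgebraicGeometry.Resolution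
open Literature.AlgebraicGeometry.Resolution.CentreBlowup
open Literature.AlgebraicGeometry.Resolution.Hauser2010
open Literature.AlgebraicGeometry.Resolution.HauserPerlega2019

variable {K : Type} [Field K] [DecidableEq K]

section Step

variable {j i u f : Fin 4} (hji : j ≠ i) (hju : j ≠ u) (hjf : j ≠ f) (hiu : i ≠ u) (hif : i ≠ f) (huf : u ≠ f)
include hji hju hjf hiu hif huf

omit [DecidableEq K] hji hju hjf hiu hif huf in
/-- «In regime» in support form implies the order / straightness hypotheses of the ♯-lemmas. [OURS · bookkeeping] -/
theorem h6_straight_of_reg {d : ℕ} {F : MvPolynomial (Fin 4) K}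
    (hreg : ∀ E ∈ F.support, d + 3 ≤ E.degree ∨
      E = Finsupp.single j 1 + Finsupp.single i 1 + Finsupp.single u 0 + Finsupp.single f d) :
    (∀ e ∈ F.support, d + 2 ≤ e.degree) ∧
      (∀ e ∈ F.support, e.degree = d + 2 → e = Finsupp.single j 1 + Finsupp.single i 1 + Finsupp.single u 0 + Finsupp.single f d) := by
  refine ⟨fun e he => ?_, fun e he hdeg => ?_⟩
  · rcases hreg e he with h | h
    · omega
    · rw [h, degree_quad]; omega
  · rcases hreg e he with h | h
    · omega
    · exact h

/-! ## 1. Propagation of the ♯-frame data through one slot step in regime R -/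

/-- **♯-FRAME PROPAGATION, chart `j`** (`d + 1 = p`, `2 ≤ d`; see the module docstring §1). [OURS] [cite: Hauser2010, §§F–G] -/
theorem sharpEntry_step_prime (p : ℕ) [hp : Fact p.Prime] {d : ℕ} (hdp : d + 1 = p) (hd2 : 2 ≤ d) (s : State K)
    (hq : ((p : ℕ) : ℕ∞) ≤ ordAlong Finset.univ s.F) (hr1 : ∀ e ∈ s.F.support, 1 ≤ e j ∧ 1 ≤ e i)
    (hreg : ∀ E ∈ s.F.support, d + 3 ≤ E.degree ∨ E = Finsupp.single j 1 + Finsupp.single i 1 + Finsupp.single u 0 + Finsupp.single f d)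
    (hled : ∀ e ∈ s.F.support, e f ≤ d - 1 → 2 ≤ e j ∧ 2 ≤ e i)
    (hR : ∀ e ∈ s.F.support, e f + 2 ≤ d → 3 ≤ e j ∧ 3 ≤ e i)
    (hlayer : ∀ E : Fin 4 →₀ ℕ, E.degree = d + 3 → E f + 2 ≤ d → coeff E s.F = 0) (β : K)
    (hq₁ : ((p : ℕ) : ℕ∞) ≤ ordAlong Finset.univ (CentreBlowup.step p Finset.univ j (Function.update (0 : Fin 4 → K) u β) s).F)
    (hreg₁ : ∀ E ∈ (CentreBlowup.step p Finset.univ j (Function.update (0 : Fin 4 → K) u β) s).F.support,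
      d + 3 ≤ E.degree ∨ E = Finsupp.single j 1 + Finsupp.single i 1 + Finsupp.single u 0 + Finsupp.single f d)
    {ℓ : Fin 4} (hℓ : ℓ = j ∨ ℓ = i) (β' : K)
    (hreg₂ : ∀ E ∈ (CentreBlowup.step p Finset.univ ℓ (Function.update (0 : Fin 4 → K) u β')
        (CentreBlowup.step p Finset.univ j (Function.update (0 : Fin 4 → K) u β) s)).F.support,
      d + 3 ≤ E.degree ∨ E = Finsupp.single j 1 + Finsupp.single i 1 + Finsupp.single u 0 + Finsupp.single f d) :
    (∀ e ∈ (CentreBlowup.step p Finset.univ j (Function.update (0 : Fin 4 → K) u β) s).F.support, 1 ≤ e j ∧ 1 ≤ e i) ∧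
      (∀ e ∈ (CentreBlowup.step p Finset.univ j (Function.update (0 : Fin 4 → K) u β) s).F.support,
        e f ≤ d - 1 → 2 ≤ e j ∧ 2 ≤ e i) ∧
      (∀ e ∈ (CentreBlowup.step p Finset.univ j (Function.update (0 : Fin 4 → K) u β) s).F.support,
        e f + 2 ≤ d → 3 ≤ e j ∧ 3 ≤ e i) ∧
      (∀ E : Fin 4 →₀ ℕ, E.degree = d + 3 → E f + 2 ≤ d →
        coeff E (CentreBlowup.step p Finset.univ j (Function.update (0 : Fin 4 → K) u β) s).F = 0) ∧
      (4 ≤ d → coeff (Finsupp.single j 3 + Finsupp.single i 3 + Finsupp.single u (d - 2) + Finsupp.single f 0)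
          (CentreBlowup.step p Finset.univ j (Function.update (0 : Fin 4 → K) u β) s).F =
        coeff (Finsupp.single j 3 + Finsupp.single i 3 + Finsupp.single u (d - 2) + Finsupp.single f 0) s.F) ∧
      (d ≤ 6 → IsIsolated p (CentreBlowup.step p Finset.univ j (Function.update (0 : Fin 4 → K) u β) s).F →
        coeff (Finsupp.single j 3 + Finsupp.single i 3 + Finsupp.single u (d - 2) + Finsupp.single f 0)
          (CentreBlowup.step p Finset.univ j (Function.update (0 : Fin 4 → K) u β) s).F ≠ 0) := by
  obtain ⟨h6, hstraight⟩ := h6_straight_of_reg hreg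
  obtain ⟨hled₁, -⟩ := ledger_step_translate_u hji hju hjf hiu hif huf p hdp hd2 s hq h6 hstraight hled β
  have h3j := three_le_apply_of_layer_step_translate_u hji hju hjf hiu hif huf p hdp s hq h6 hstraight hlayer β
  have h3i := le_apply_of_step_translate_other hji.symm hiu hif hju hjf huf p (d := d) (n := 3) s hq
    (fun E hE hEf => (hR E hE hEf).2) β
  have hR₁ : ∀ e ∈ (CentreBlowup.step p Finset.univ j (Function.update (0 : Fin 4 → K) u β) s).F.support,
      e f + 2 ≤ d → 3 ≤ e j ∧ 3 ≤ e i := fun e he hef => ⟨h3j e he hef, h3i e he hef⟩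
  -- LAYER of the child: same letter directly, letter change with the killer hypothesis discharged by regime R
  have hlayer₁ : ∀ E : Fin 4 →₀ ℕ, E.degree = d + 3 → E f + 2 ≤ d →
      coeff E (CentreBlowup.step p Finset.univ j (Function.update (0 : Fin 4 → K) u β) s).F = 0 := by
    rcases hℓ with rfl | rfl
    · exact layer_step_same_prime hji hju hjf hiu hif huf p hdp hd2 s hq h6 hstraight hlayer β β' hq₁ hreg₂
    · refine layer_step_change_prime hji hju hjf hiu hif huf p hdp hd2 s hq h6 hstraight hled hlayer β β' hq₁ ?_ hreg₂
      intro a c ha hc hac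
      by_contra hne
      have hmem := mem_support_iff.mpr hne
      have h3 := (hR₁ _ hmem (by rw [(quad_apply hji hju hjf hiu hif huf a 2 (d + 1 - c - a) c).2.2.2]; exact hc)).2
      rw [(quad_apply hji hju hjf hiu hif huf a 2 (d + 1 - c - a) c).2.1] at h3
      omega
  have hr1₁ : ∀ e ∈ (CentreBlowup.step p Finset.univ j (Function.update (0 : Fin 4 → K) u β) s).F.support,
      1 ≤ e j ∧ 1 ≤ e i := by
    intro E hE
    obtain ⟨δ, hmem, hm, hi, -, -⟩ := exists_parent_of_mem_support_step_translate_u hji hju hjf hiu hif huf p s hq β hE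
    have := h6 δ hmem
    exact ⟨by omega, by rw [← hi]; exact (hr1 δ hmem).2⟩
  have hlay₁' : ∀ E ∈ (CentreBlowup.step p Finset.univ j (Function.update (0 : Fin 4 → K) u β) s).F.support,
      d + 4 ≤ E.degree ∨ d < E f + 2 ∨
        E = Finsupp.single j 1 + Finsupp.single i 1 + Finsupp.single u 0 + Finsupp.single f d := by
    intro E hE
    rcases hreg₁ E hE with h | h
    · by_cases hEf : E f + 2 ≤ d
      · rcases Nat.eq_or_lt_of_le h with heq | hlt
        · exact absurd (hlayer₁ E heq.symm hEf) (mem_support_iff.mp hE)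
        · exact Or.inl hlt
      · exact Or.inr (Or.inl (by omega))
    · exact Or.inr (Or.inr h)
  refine ⟨hr1₁, hled₁, hR₁, hlayer₁, fun hd4 => ?_, fun hd6 hiso₁ => ?_⟩
  · exact coeff_sharpFlag_step_translate_u hji hju hjf hiu hif huf p hdp hd4 s hq (fun e he hef => (hR e he (by omega)).1) β
  · exact coeff_sharpFlag_ne_zero_of_isIsolated hji hju hjf hiu hif huf p hdp hd6 s hq h6 hr1 hR β hlay₁' hiso₁

/-! ## 2. From a flagless letter change to regime R -/

/-- **ENTRY♯ START** (`d + 1 = p`, `2 ≤ d`; module docstring §2): parent `s` in regime with slot exponents `≥ 1`, the exact ledger and NO u-row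
flag (`coeff x_j²x_i²x_u^{d−1−c}x_f^c = 0`, `c + 2 ≤ d`); `S₁ = κ(β₀)` in regime and free of κ-killers `x_j^{a}x_i²x_u^{d+1−c−a}x_f^c` (`3 ≤ a`,
`c + 2 ≤ d`); `S₂ = o(β₁) S₁` in regime; `S₃ = ℓ(β₂) S₂` (`ℓ ∈ {κ, o}`) in regime.  THEN `S₂` has slot exponents `≥ 1`, the exact ledger, REGIME R and
LAYER — the hypotheses of `sharpEntry_step_prime`, which then carries them (and the ♯-flag) along the rest of the chain. [OURS]
[cite: Hauser2010, §§F–G] [cite: CossartJannsenSaito2020, Thm. 3.14] -/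
theorem sharpEntry_start_prime (p : ℕ) [hp : Fact p.Prime] {d : ℕ} (hdp : d + 1 = p) (hd2 : 2 ≤ d) (s : State K)
    (hq : ((p : ℕ) : ℕ∞) ≤ ordAlong Finset.univ s.F) (hr1 : ∀ e ∈ s.F.support, 1 ≤ e j ∧ 1 ≤ e i)
    (hreg : ∀ E ∈ s.F.support, d + 3 ≤ E.degree ∨ E = Finsupp.single j 1 + Finsupp.single i 1 + Finsupp.single u 0 + Finsupp.single f d)
    (hled : ∀ e ∈ s.F.support, e f ≤ d - 1 → 2 ≤ e j ∧ 2 ≤ e i)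
    (hflag : ∀ c, c + 2 ≤ d →
      coeff (Finsupp.single j 2 + Finsupp.single i 2 + Finsupp.single u (d - 1 - c) + Finsupp.single f c) s.F = 0)
    (β₀ : K)
    (hq₁ : ((p : ℕ) : ℕ∞) ≤ ordAlong Finset.univ (CentreBlowup.step p Finset.univ j (Function.update (0 : Fin 4 → K) u β₀) s).F)
    (hreg₁ : ∀ E ∈ (CentreBlowup.step p Finset.univ j (Function.update (0 : Fin 4 → K) u β₀) s).F.support,
      d + 3 ≤ E.degree ∨ E = Finsupp.single j 1 + Finsupp.single i 1 + Finsupp.single u 0 + Finsupp.single f d)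
    (hnokill₁ : ∀ a c : ℕ, 3 ≤ a → c + 2 ≤ d → a ≤ d + 1 - c →
      coeff (Finsupp.single j a + Finsupp.single i 2 + Finsupp.single u (d + 1 - c - a) + Finsupp.single f c)
        (CentreBlowup.step p Finset.univ j (Function.update (0 : Fin 4 → K) u β₀) s).F = 0)
    (β₁ : K)
    (hq₂ : ((p : ℕ) : ℕ∞) ≤ ordAlong Finset.univ (CentreBlowup.step p Finset.univ i (Function.update (0 : Fin 4 → K) u β₁)
      (CentreBlowup.step p Finset.univ j (Function.update (0 : Fin 4 → K) u β₀) s)).F)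
    (hreg₂ : ∀ E ∈ (CentreBlowup.step p Finset.univ i (Function.update (0 : Fin 4 → K) u β₁)
        (CentreBlowup.step p Finset.univ j (Function.update (0 : Fin 4 → K) u β₀) s)).F.support,
      d + 3 ≤ E.degree ∨ E = Finsupp.single j 1 + Finsupp.single i 1 + Finsupp.single u 0 + Finsupp.single f d)
    {ℓ : Fin 4} (hℓ : ℓ = j ∨ ℓ = i) (β₂ : K)
    (hreg₃ : ∀ E ∈ (CentreBlowup.step p Finset.univ ℓ (Function.update (0 : Fin 4 → K) u β₂)
        (CentreBlowup.step p Finset.univ i (Function.update (0 : Fin 4 → K) u β₁)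
          (CentreBlowup.step p Finset.univ j (Function.update (0 : Fin 4 → K) u β₀) s))).F.support,
      d + 3 ≤ E.degree ∨ E = Finsupp.single j 1 + Finsupp.single i 1 + Finsupp.single u 0 + Finsupp.single f d) :
    (∀ e ∈ (CentreBlowup.step p Finset.univ i (Function.update (0 : Fin 4 → K) u β₁)
        (CentreBlowup.step p Finset.univ j (Function.update (0 : Fin 4 → K) u β₀) s)).F.support, 1 ≤ e j ∧ 1 ≤ e i) ∧
      (∀ e ∈ (CentreBlowup.step p Finset.univ i (Function.update (0 : Fin 4 → K) u β₁)
        (CentreBlowup.step p Finset.univ j (Function.update (0 : Fin 4 → K) u β₀) s)).F.support, e f ≤ d - 1 → 2 ≤ e j ∧ 2 ≤ e i) ∧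
      (∀ e ∈ (CentreBlowup.step p Finset.univ i (Function.update (0 : Fin 4 → K) u β₁)
        (CentreBlowup.step p Finset.univ j (Function.update (0 : Fin 4 → K) u β₀) s)).F.support, e f + 2 ≤ d → 3 ≤ e j ∧ 3 ≤ e i) ∧
      (∀ E : Fin 4 →₀ ℕ, E.degree = d + 3 → E f + 2 ≤ d →
        coeff E (CentreBlowup.step p Finset.univ i (Function.update (0 : Fin 4 → K) u β₁)
          (CentreBlowup.step p Finset.univ j (Function.update (0 : Fin 4 → K) u β₀) s)).F = 0) := by
  set S₁ := CentreBlowup.step p Finset.univ j (Function.update (0 : Fin 4 → K) u β₀) s with hS₁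
  set S₂ := CentreBlowup.step p Finset.univ i (Function.update (0 : Fin 4 → K) u β₁) S₁ with hS₂
  obtain ⟨h6, hstraight⟩ := h6_straight_of_reg hreg
  obtain ⟨h6₁, hstraight₁⟩ := h6_straight_of_reg hreg₁
  -- the cone written with the slots exchanged, for the mirror lemmas
  have hcone : (Finsupp.single j 1 + Finsupp.single i 1 + Finsupp.single u 0 + Finsupp.single f d : Fin 4 →₀ ℕ) =
      Finsupp.single i 1 + Finsupp.single j 1 + Finsupp.single u 0 + Finsupp.single f d := gameExp_swap 1 1 0 d
  have hstraight₁' : ∀ e ∈ S₁.F.support, e.degree = d + 2 →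
      e = Finsupp.single i 1 + Finsupp.single j 1 + Finsupp.single u 0 + Finsupp.single f d := fun e he hd =>
    (hstraight₁ e he hd).trans hcone
  have hreg₂' : ∀ E ∈ S₂.F.support, d + 3 ≤ E.degree ∨
      E = Finsupp.single i 1 + Finsupp.single j 1 + Finsupp.single u 0 + Finsupp.single f d := fun E hE =>
    (hreg₂ E hE).imp_right fun h => h.trans hcone
  have hreg₃' : ∀ E ∈ (CentreBlowup.step p Finset.univ ℓ (Function.update (0 : Fin 4 → K) u β₂) S₂).F.support,
      d + 3 ≤ E.degree ∨ E = Finsupp.single i 1 + Finsupp.single j 1 + Finsupp.single u 0 + Finsupp.single f d := fun E hE =>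
    (hreg₃ E hE).imp_right fun h => h.trans hcone
  -- the flag of `S₁` is the flag of `s`: zero
  have hflag₁ : ∀ c, c + 2 ≤ d →
      coeff (Finsupp.single j 2 + Finsupp.single i 2 + Finsupp.single u (d - 1 - c) + Finsupp.single f c) S₁.F = 0 := by
    intro c hc
    rw [hS₁, coeff_flag_step_translate_u hji hju hjf hiu hif huf p hdp hd2 s hq (fun e he hef => (hled e he hef).1) β₀ hc, hflag c hc]
  -- LC: the parent is LAYER; then the κ-child is LAYER
  have hlayer₀ := letterChange_layer_prime hji hju hjf hiu hif huf p hdp hd2 s hq h6 hstraight hled β₀ β₁ hq₁ hreg₁ hflag₁ hreg₂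
  have hlayer₁ := layer_step_change_prime hji hju hjf hiu hif huf p hdp hd2 s hq h6 hstraight hled hlayer₀ β₀ β₁ hq₁ hnokill₁ hreg₂
  obtain ⟨hled₁, -⟩ := ledger_step_translate_u hji hju hjf hiu hif huf p hdp hd2 s hq h6 hstraight hled β₀
  have h3j₁ := three_le_apply_of_layer_step_translate_u hji hju hjf hiu hif huf p hdp s hq h6 hstraight hlayer₀ β₀
  -- slot exponents ≥ 1 survive
  have hr1₁ : ∀ e ∈ S₁.F.support, 1 ≤ e j ∧ 1 ≤ e i := by
    intro E hE
    obtain ⟨δ, hmem, hm, hi, -, -⟩ := exists_parent_of_mem_support_step_translate_u hji hju hjf hiu hif huf p s hq β₀ hE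
    have := h6 δ hmem
    exact ⟨by omega, by rw [← hi]; exact (hr1 δ hmem).2⟩
  have hr1₂ : ∀ e ∈ S₂.F.support, 1 ≤ e j ∧ 1 ≤ e i := by
    intro E hE
    obtain ⟨δ, hmem, hm, hj, -, -⟩ := exists_parent_of_mem_support_step_translate_u hji.symm hiu hif hju hjf huf p S₁ hq₁ β₁ hE
    have := h6₁ δ hmem
    exact ⟨by rw [← hj]; exact (hr1₁ δ hmem).1, by omega⟩
  -- the o-child S₂: ledger (mirror transport), regime R, LAYER (mirror step lemmas)
  have hled₁' : ∀ e ∈ S₁.F.support, e f ≤ d - 1 → 2 ≤ e i ∧ 2 ≤ e j := fun e he hef => (hled₁ e he hef).symm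
  obtain ⟨hled₂', -⟩ := ledger_step_translate_u hji.symm hiu hif hju hjf huf p hdp hd2 S₁ hq₁ h6₁ hstraight₁' hled₁' β₁
  have hled₂ : ∀ e ∈ S₂.F.support, e f ≤ d - 1 → 2 ≤ e j ∧ 2 ≤ e i := fun e he hef => (hled₂' e he hef).symm
  have h3i₂ := three_le_apply_of_layer_step_translate_u hji.symm hiu hif hju hjf huf p hdp S₁ hq₁ h6₁ hstraight₁' hlayer₁ β₁
  have h3j₂ := le_apply_of_step_translate_other hji hju hjf hiu hif huf p (d := d) (n := 3) S₁ hq₁ h3j₁ β₁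
  have hR₂ : ∀ e ∈ S₂.F.support, e f + 2 ≤ d → 3 ≤ e j ∧ 3 ≤ e i := fun e he hef => ⟨h3j₂ e he hef, h3i₂ e he hef⟩
  have hlayer₂ : ∀ E : Fin 4 →₀ ℕ, E.degree = d + 3 → E f + 2 ≤ d → coeff E S₂.F = 0 := by
    rcases hℓ with rfl | rfl
    · -- o then κ: mirror letter change; the o-killers have e_j = 2, absent since e_j ≥ 3 in S₂
      refine layer_step_change_prime hji.symm hiu hif hju hjf huf p hdp hd2 S₁ hq₁ h6₁ hstraight₁' hled₁' hlayer₁ β₁ β₂ hq₂ ?_ hreg₃'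
      intro a c ha hc hac
      by_contra hne
      have hmem := mem_support_iff.mpr hne
      have h3 := (hR₂ _ hmem (by rw [(quad_apply hji.symm hiu hif hju hjf huf a 2 (d + 1 - c - a) c).2.2.2]; exact hc)).1
      rw [(quad_apply hji.symm hiu hif hju hjf huf a 2 (d + 1 - c - a) c).2.1] at h3
      omega
    · exact layer_step_same_prime hji.symm hiu hif hju hjf huf p hdp hd2 S₁ hq₁ h6₁ hstraight₁' hlayer₁ β₁ β₂ hq₂ hreg₃'
  exact ⟨hr1₂, hled₂, hR₂, hlayer₂⟩

end Step

end ResCone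

end Summit.ResolutionOfSingularities.ResolutionOfSingularities.Theorems.PIDim4
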